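import Summits.ResolutionOfSingularities.ResolutionOfSingularities.Theorems.MarkedTransferCampaignW46WWalkStepForms
import Summits.ResolutionOfSingularities.ResolutionOfSingularities.Theorems.MarkedTransferCampaignW46MohWindowShadeFormalStep
import HarnessLib

/-!
# [OURS · L1 W4.6 rung (iii-2)] THE W-WALK: the FORMAL STEP along a point blow-up (scheme level) for a GENERAL window germ —
# the transform of a `w`-anchor `w · (z^p + f)` at a singular point is a `w`-anchor of `z^p + chartT p l f` (a `T`-step) or of
# `z^p + chartT p 0 (swapTY f)` (the sharp-vertical step)

Cell `res-hironaka`, LADDER-RESOLUTION rung L (D-0089), slot W4.6 rung (iii); seat res-L1-s46-pv-5 (gen 6), plan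
`HOME/L/res-L1-s46-pv-5/W-WALK-PLAN.md` §3 [E] / §4. Host route MarkedTransfer, `--supports stmt-ResolutionOfSingularities-16155 --as helper`;
kind proof (def-free). Template (scheme plumbing copied): res-L1-s46-pv-6 `…MohWindowShadeFormalInsepStep.exists_formalInsepAnchor_step`;
ring-level cores: `…WWalkStepCore.exists_ringEquiv_transform_wAnchor_T`, `…WWalkStepForms.exists_ringEquiv_transform_wAnchor_V`,
`…WWalkStepForms.not_mem_pow_of_zChart`.

HONEST FRAMING. OURS; nothing here is a statement of H. Hironaka's manuscript [Hironaka2017] and nothing of it is used. AI-written;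
AI review is weaker than expert review. No `sorry`; axioms standard. [cite: StacksProject, Tag 0804] [cite: Matsumura1987, Thm. 8.11]
-/

noncomputable section

set_option linter.dupNamespace false -- mandated namespace of this single-conjunct summit

open MvPowerSeries IsLocalRing
open Literature.AlgebraicGeometry.Resolution

namespace Summit.ResolutionOfSingularities.ResolutionOfSingularities.Theorems

namespace CampaignW46

namespace WWalk

open CampaignW46.FormalChart

section Scheme

open CategoryTheory AlgebraicGeometry TopologicalSpace
open Literature.AlgebraicGeometry.Hironaka2017.S02Preliminaries
open Literature.AlgebraicGeometry.Hironaka2017.Datum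
open Scheme.IdealSheafData
open CampaignW46.ChartPoint

variable {p : ℕ} [hp : Fact p.Prime] {K : Type} [Field K] [CharP K p]

/-- **THE FORMAL STEP FOR A GENERAL WINDOW GERM (scheme level).** Let `π : Z′ → Z` be the blow-up of an ambient datum along the reduced
ideal of the closed point `ξ = π(ξ′) ∈ Sing(E)`, `E.b = p`, `𝒪_{Z,ξ}` of embedding dimension `3`, `ξ′ ∈ Sing(E′)` residually rational over `ξ`,
and let `J_ξ = (f₀)` carry a `w`-ANCHOR `E₀(f₀) = w · (z^p + f)` with `ord f ≥ p + 1` (`f ∈ K⟦t,y,z⟧` ARBITRARY). Then `J′_{ξ′} = (f′)` carries a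
`w`-anchor `E′(f′) = w′ · (z^p + f₁)` where EITHER `f₁ = chartT p l f` for some `l ∈ K` (the point is `(1 : l : 0)`, a `T`-step) OR
`f₁ = chartT p 0 (swapTY f)` (the point is `(0 : 1 : 0)`, the sharp-vertical step); the `z`-chart origin is never singular.
[cite: StacksProject, Tag 0804] [cite: Matsumura1987, Thm. 8.11] -/
theorem exists_wAnchor_step {A A' : AmbientDatum p K} (π : A'.Z ⟶ A.Z) (D : Closeds A.Z) (hπ : IsBlowup π (vanishingIdeal D))
    {E : IdealExponent A.Z} (hb : E.b = p) {ξ' : A'.Z} (hD : (D : Set A.Z) = {π.base ξ'}) (hξ : π.base ξ' ∈ E.sing)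
    (hξ' : ξ' ∈ (E.transform π D).sing) (h3 : (maximalIdeal (A.Z.presheaf.stalk (π.base ξ'))).spanFinrank = 3)
    (hrat : ∀ y : A'.Z.presheaf.stalk ξ', ∃ r : A.Z.presheaf.stalk (π.base ξ'),
      y - (π.stalkMap ξ').hom r ∈ maximalIdeal (A'.Z.presheaf.stalk ξ'))
    (E₀ : AdicCompletion (maximalIdeal (A.Z.presheaf.stalk (π.base ξ'))) (A.Z.presheaf.stalk (π.base ξ')) ≃+*
      MvPowerSeries (Option (Fin 2)) K)
    {f₀ : A.Z.presheaf.stalk (π.base ξ')} (hJ : stalkIdeal E.J (π.base ξ') = Ideal.span {f₀}) {w : MvPowerSeries (Option (Fin 2)) K}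
    (hw : IsUnit w) (f : MvPowerSeries (Option (Fin 2)) K) (hfP2 : LowVanish (p + 1) f)
    (hE₀ : E₀ (algebraMap _ _ f₀) = w * (MvPowerSeries.X none ^ p + f)) :
    ∃ (E' : AdicCompletion (maximalIdeal (A'.Z.presheaf.stalk ξ')) (A'.Z.presheaf.stalk ξ') ≃+* MvPowerSeries (Option (Fin 2)) K)
      (f' : A'.Z.presheaf.stalk ξ') (w' : MvPowerSeries (Option (Fin 2)) K),
      stalkIdeal (E.transform π D).J ξ' = Ideal.span {f'} ∧ IsUnit w' ∧
      ((∃ l : K, E' (algebraMap _ _ f') = w' * (MvPowerSeries.X none ^ p + chartT p l f)) ∨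
        E' (algebraMap _ _ f') = w' * (MvPowerSeries.X none ^ p + chartT p (0 : K) (swapTY f))) := by
  classical
  haveI : IsLocallyNoetherian A'.Z := ambient_isLocallyNoetherian A'
  haveI : IsRegularLocalRing (A.Z.presheaf.stalk (π.base ξ')) := ambient_isRegular A _
  haveI : IsRegularLocalRing (A'.Z.presheaf.stalk ξ') := ambient_isRegular A' _
  set g := (π.stalkMap ξ').hom with hgdef
  have hloc : IsLocalHom g := inferInstance
  have hg : (maximalIdeal (A.Z.presheaf.stalk (π.base ξ'))).map g ≤ maximalIdeal (A'.Z.presheaf.stalk ξ') :=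
    ((IsLocalRing.local_hom_TFAE g).out 0 2).mp hloc
  -- an adapted regular system of parameters at `π ξ′`
  obtain ⟨c, hc, hcX⟩ := exists_rsop_adapted E₀
  have hcl : IsClosed ({π.base ξ'} : Set A.Z) := hD ▸ D.isClosed
  have hcJ : Ideal.span (Set.range c) = stalkIdeal (vanishingIdeal D) (π.base ξ') := by
    rw [hc, stalkIdeal_vanishingIdeal_eq_maximalIdeal_of_closure_eq]
    rw [hD, hcl.closure_eq]
  have hd' : (maximalIdeal (A.Z.presheaf.stalk (π.base ξ'))).spanFinrank = Fintype.card (Option (Fin 2)) := by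
    rw [h3]; simp
  obtain ⟨i, e, τ, he, hei, hnzd, hgen, -, hdim⟩ := exists_stalk_chartData_nzd hπ ξ' c hcJ hc hd' hrat
  -- `f₀ ∈ 𝔪^p`
  have hf₀𝔪 : f₀ ∈ maximalIdeal (A.Z.presheaf.stalk (π.base ξ')) ^ p := by
    have h := (le_idealOrder_iff E.J _ E.b).mp hξ
    rw [hJ, Ideal.span_singleton_le_iff_mem, hb] at h
    exact h
  -- the conclusion from chart data in a `u`-chart `some i₀` with the frame condition (`i₀ = 1 → τ_t ∈ 𝔪`)
  have tail : ∀ (i₀ : Fin 2) (e : Option (Fin 2) → A'.Z.presheaf.stalk ξ') (τ : Option (Fin 2) → A.Z.presheaf.stalk (π.base ξ')),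
      (∀ j, g (c j) = g (c (some i₀)) * e j) → g (c (some i₀)) ∈ nonZeroDivisors (A'.Z.presheaf.stalk ξ') →
      Ideal.span (Set.range fun j : Option (Fin 2) => if j = some i₀ then g (c (some i₀)) else e j - g (τ j)) =
        maximalIdeal (A'.Z.presheaf.stalk ξ') →
      (i₀ = 1 → τ (some 0) ∈ maximalIdeal (A.Z.presheaf.stalk (π.base ξ'))) →
      ∃ (E' : AdicCompletion (maximalIdeal (A'.Z.presheaf.stalk ξ')) (A'.Z.presheaf.stalk ξ') ≃+* MvPowerSeries (Option (Fin 2)) K)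
        (f' : A'.Z.presheaf.stalk ξ') (w' : MvPowerSeries (Option (Fin 2)) K),
        stalkIdeal (E.transform π D).J ξ' = Ideal.span {f'} ∧ IsUnit w' ∧
        ((∃ l : K, E' (algebraMap _ _ f') = w' * (MvPowerSeries.X none ^ p + chartT p l f)) ∨
          E' (algebraMap _ _ f') = w' * (MvPowerSeries.X none ^ p + chartT p (0 : K) (swapTY f))) := by
    intro i₀ e τ he hnzd hgen hHW
    obtain ⟨f', hf'⟩ := exists_eq_pow_mul_of_mem_pow g c hc (some i₀) e he hf₀𝔪
    have hJ' : stalkIdeal (E.transform π D).J ξ' = Ideal.span {f'} :=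
      stalkIdeal_transform_eq_span hπ ξ' c hcJ (some i₀) e he hnzd E f₀ hJ f' (by rw [hb]; exact hf')
    have hf'𝔪 : f' ∈ maximalIdeal (A'.Z.presheaf.stalk ξ') ^ p := by
      have h := (mem_sing_transform_iff E ξ' f' hJ').mp hξ'
      rwa [hb] at h
    by_cases h0 : i₀ = 0
    · subst h0
      obtain ⟨E', w', hw', hE'⟩ := exists_ringEquiv_transform_wAnchor_T g hg E₀ c hc hcX 0 e he τ hgen hrat hdim rfl f hfP2 f₀ w hw
        hE₀ f' hf' hf'𝔪
      exact ⟨E', f', w', hJ', hw', Or.inl ⟨_, hE'⟩⟩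
    · have h1 : i₀ = 1 := by
        rcases i₀ with ⟨_ | _ | k, hk⟩
        · exact absurd rfl h0
        · rfl
        · omega
      subst h1
      have hτt : MvPowerSeries.constantCoeff (E₀ (algebraMap _ _ (τ (some 0)))) = 0 :=
        Literature.RingTheory.MvPowerSeries.Jets.mem_maximalIdeal_iff_constantCoeff_eq_zero.mp (ringEquiv_mem_maximalIdeal E₀
          (by rw [AdicCompletion.maximalIdeal_eq_map]; exact Ideal.mem_map_of_mem _ (hHW rfl)))
      obtain ⟨E', w', hw', hE'⟩ := exists_ringEquiv_transform_wAnchor_V g hg E₀ c hc hcX 1 e he τ hgen hrat hdim rfl hτt f hfP2 f₀ w hw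
        hE₀ f' hf' hf'𝔪
      exact ⟨E', f', w', hJ', hw', Or.inr hE'⟩
  -- from chart data in any `u`-chart: move to the frame if needed (chart `u₁` at a point with `τ_{u₀}` a unit ↦ chart `u₀`)
  have tail2 : ∀ (i₀ : Fin 2) (e : Option (Fin 2) → A'.Z.presheaf.stalk ξ') (τ : Option (Fin 2) → A.Z.presheaf.stalk (π.base ξ')),
      (∀ j, g (c j) = g (c (some i₀)) * e j) → e (some i₀) = 1 → g (c (some i₀)) ∈ nonZeroDivisors (A'.Z.presheaf.stalk ξ') →
      Ideal.span (Set.range fun j : Option (Fin 2) => if j = some i₀ then g (c (some i₀)) else e j - g (τ j)) =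
        maximalIdeal (A'.Z.presheaf.stalk ξ') →
      ∃ (E' : AdicCompletion (maximalIdeal (A'.Z.presheaf.stalk ξ')) (A'.Z.presheaf.stalk ξ') ≃+* MvPowerSeries (Option (Fin 2)) K)
        (f' : A'.Z.presheaf.stalk ξ') (w' : MvPowerSeries (Option (Fin 2)) K),
        stalkIdeal (E.transform π D).J ξ' = Ideal.span {f'} ∧ IsUnit w' ∧
        ((∃ l : K, E' (algebraMap _ _ f') = w' * (MvPowerSeries.X none ^ p + chartT p l f)) ∨
          E' (algebraMap _ _ f') = w' * (MvPowerSeries.X none ^ p + chartT p (0 : K) (swapTY f))) := by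
    intro i₀ e τ he hei hnzd hgen
    by_cases hHW : i₀ = 1 → τ (some 0) ∈ maximalIdeal (A.Z.presheaf.stalk (π.base ξ'))
    · exact tail i₀ e τ he hnzd hgen hHW
    · rw [Classical.not_imp] at hHW
      obtain ⟨h1, hτ0⟩ := hHW
      subst h1
      have hu : IsUnit (τ (some 0)) := (IsLocalRing.notMem_maximalIdeal).mp hτ0
      obtain ⟨e', τ', he', -, hgen'⟩ := exists_chartData_reindex g c (some (1 : Fin 2)) e he hei τ hgen (some 0) (by decide) hu
      have he0 : IsUnit (e (some 0)) := by
        refine isUnit_of_sub_mem_maximalIdeal (hu.map g) ?_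
        rw [← hgen]
        exact Ideal.subset_span ⟨some 0, by dsimp only; rw [if_neg (by decide)]⟩
      have hnzd' : g (c (some 0)) ∈ nonZeroDivisors (A'.Z.presheaf.stalk ξ') := by
        rw [he (some 0)]
        exact mul_mem hnzd he0.mem_nonZeroDivisors
      exact tail 0 e' τ' he' hnzd' hgen' (fun h => absurd h (by decide))
  -- case on the chart index delivered by the Rees chart
  cases i with
  | some i₀ => exact tail2 i₀ e τ he hei hnzd hgen
  | none =>
    by_cases hτ : ∀ j : Fin 2, τ (some j) ∈ maximalIdeal (A.Z.presheaf.stalk (π.base ξ'))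
    · -- the origin of the `z`-chart is not singular
      exfalso
      obtain ⟨f', hf'⟩ := exists_eq_pow_mul_of_mem_pow g c hc none e he hf₀𝔪
      have hJ' : stalkIdeal (E.transform π D).J ξ' = Ideal.span {f'} :=
        stalkIdeal_transform_eq_span hπ ξ' c hcJ none e he hnzd E f₀ hJ f' (by rw [hb]; exact hf')
      have hf'𝔪 : f' ∈ maximalIdeal (A'.Z.presheaf.stalk ξ') ^ p := by
        have h := (mem_sing_transform_iff E ξ' f' hJ').mp hξ'
        rwa [hb] at h
      exact not_mem_pow_of_zChart g hg E₀ c hc hcX hrat hdim e he τ hgen f hfP2 f₀ w hw hE₀ f' hf' hf'𝔪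
    · simp only [not_forall] at hτ
      obtain ⟨j₀, hj₀⟩ := hτ
      have hu : IsUnit (τ (some j₀)) := (IsLocalRing.notMem_maximalIdeal).mp hj₀
      obtain ⟨e', τ', he', hei', hgen'⟩ := exists_chartData_reindex g c none e he hei τ hgen (some j₀) (Option.some_ne_none j₀) hu
      have hej₀ : IsUnit (e (some j₀)) := by
        refine isUnit_of_sub_mem_maximalIdeal (hu.map g) ?_
        rw [← hgen]
        exact Ideal.subset_span ⟨some j₀, by dsimp only; rw [if_neg (Option.some_ne_none j₀)]⟩
      have hnzd' : g (c (some j₀)) ∈ nonZeroDivisors (A'.Z.presheaf.stalk ξ') := by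
        rw [he (some j₀)]
        exact mul_mem hnzd hej₀.mem_nonZeroDivisors
      exact tail2 j₀ e' τ' he' hei' hnzd' hgen'

end Scheme

end WWalk

end CampaignW46

end Summit.ResolutionOfSingularities.ResolutionOfSingularities.Theorems

end
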